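import Summits.Ventures.PackingBounds.ThreePointCert.K14d17AggG1
import Summits.Ventures.PackingBounds.ThreePointCert.K14d17AggG2
import Summits.Ventures.PackingBounds.ThreePointCert.K14d17AggG3
import Summits.Ventures.PackingBounds.ThreePointCert.K14d17AggP

import Summits.Ventures.PackingBounds.ThreePointCert.K14d17CheckIdS
import Summits.Ventures.PackingBounds.ThreePointCert.CheckIdKSMT

/-!
# κ(14) ≤ 3176: identity (ii') at the TRANSPOSED points (2^(551·35), 2^551, τ), τ = 15 … 17 of 35 (multi-point Kronecker check `CheckIdKSMT.idIIAtG`, file 6 of 12; sequential elaboration)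

Framing: lottery ticket; floor = certified bounds/negative ranges. Venture `PackingBounds` (cell
`pub-packcert`), three-point SDP family, kissing column. Integer data / kernel checks of a feasible point of the
Bachoc–Vallentin semidefinite program (n = 14, s = 1/2, three-point matrix degree 17, two-point (Gegenbauer) part to
degree L = 34, Bachoc–Vallentin multiplier set = cell mode sym2; exact rational certificate `sdp-n14-d17-s1-2-sym2-a34-hyb8dd-j162674.json`
(sha256 51678ae29b30364383f5b0ccf59bd3d3a7260747eef143b772e0a5830bcc80a9) of the sdp seat's hybrid pipeline, verified by the cell's two exact verifiers), converted by
`cert2lean_g9.py` (lp gen 9; S = 80) into the units of the kernel checker `ThreePointCert.Check` + `CheckSym2` with the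
record degree field set to L = 34 (the checker's degree enters only the unit `W = 2^d·d!` and the side conditions, so a
(d, L) certificate is a `Cert3` of degree L); symmetry-adapted PARTS (S₃/S₂ isotypic bases of short polynomials) with coarse factor COLUMNS, validated by
Kronecker substitution `ThreePointCert.CheckKSP` (`sosCheckKSParts`: the claimed expansion and `Σ_parts Σ_k col_k²` compared at `(2^w, 2^{wD}, 2^{wD²})`); three-point part by `CheckFKS`;
split check of (ii') `ThreePointCert.CheckSym2Split`. Emitter `emitlean_ks3.py` (lp gen 10; expansions `4^k • Σ_parts pᵀ(L′L′ᵀ)p` lifted by `SoundNN.boxNonneg_smul`). Generated file: plain lists of integers / monomials.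
-/


namespace Summit.Ventures.PackingBounds.ThreePointCert.K14d17

open Literature.Geometry.DiscreteGeometry Literature.Geometry.DiscreteGeometry.PolyCert PolyCert.SPoly

/- sequential elaboration: one point at a time (kernel memory) -/
set_option Elab.async false

set_option maxRecDepth 100000 in
set_option maxHeartbeats 0 in
/-- Identity `(ii')` at the transposed point `(2^(551·35), 2^551, 15)`: `qII = 0` there, from the flat leaves (grouped evaluation; the large weight `2^(551·35·a)` enters once per `a`-block, run flushes carry `2^(551·b)`; kernel). -/
theorem pT_15 : idIIAtG (2 ^ (551 * 35)) (2 ^ 551) 15 K14d17.cert FPc E0c E1c E2c E3c E4c RHc K14d17.cR0 K14d17.cR1 K14d17.cR2 K14d17.cR3 K14d17.cR4 = true := by decide +kernel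

set_option maxRecDepth 100000 in
set_option maxHeartbeats 0 in
/-- Identity `(ii')` at the transposed point `(2^(551·35), 2^551, 16)`: `qII = 0` there, from the flat leaves (grouped evaluation; the large weight `2^(551·35·a)` enters once per `a`-block, run flushes carry `2^(551·b)`; kernel). -/
theorem pT_16 : idIIAtG (2 ^ (551 * 35)) (2 ^ 551) 16 K14d17.cert FPc E0c E1c E2c E3c E4c RHc K14d17.cR0 K14d17.cR1 K14d17.cR2 K14d17.cR3 K14d17.cR4 = true := by decide +kernel

set_option maxRecDepth 100000 in
set_option maxHeartbeats 0 in
/-- Identity `(ii')` at the transposed point `(2^(551·35), 2^551, 17)`: `qII = 0` there, from the flat leaves (grouped evaluation; the large weight `2^(551·35·a)` enters once per `a`-block, run flushes carry `2^(551·b)`; kernel). -/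
theorem pT_17 : idIIAtG (2 ^ (551 * 35)) (2 ^ 551) 17 K14d17.cert FPc E0c E1c E2c E3c E4c RHc K14d17.cR0 K14d17.cR1 K14d17.cR2 K14d17.cR3 K14d17.cR4 = true := by decide +kernel

end Summit.Ventures.PackingBounds.ThreePointCert.K14d17
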